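import Literature.Analysis.FunctionSpaces.WightmanGNSReconstruction
import Literature.Analysis.FunctionSpaces.SchwartzExchange
import Literature.Analysis.FunctionSpaces.SchwartzParametric
import Literature.MathematicalPhysics.QuantumLattice.SchwartzTranslationCutoff
import Mathlib.Analysis.Distribution.SchwartzSpace.Fourier
import Mathlib.Analysis.Fourier.FourierTransform
import HarnessLib

/-!
# The spectral condition of the reconstructed translation group

Streater–Wightman (1964), §3-4, proof of Thm. 3-7, p. 110 (an immediate consequence of (3-44)):
the spectral condition (b) of
the Wightman distributions implies that the strongly continuous unitary translation group of
the GNS Hilbert space has its Fourier spectrum in the closed forward cone. This file discharges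
the named fact `Literature.Analysis.FunctionSpaces.GNS_spectral_condition` (`WightmanGNS`) and hence proves
`Literature.Analysis.FunctionSpaces.wightman_reconstruction_exists` for `d ≥ 1` (`wightman_reconstruction_exists_holds`).

Proof. By density and sesquilinearity it suffices to treat matrix coefficients of basis
vectors, `a ↦ ⟪[δ_l], U(a) [δ_{l'}]⟫ = 𝒲_N(T₁ ⊗ τ_a T₂)` (`T₁ = ⊗ l†`, `T₂ = ⊗ l'`). On the
Fourier side (flattened variables `P`), `𝓕(T₁ ⊗ τ_a T₂) = e^{-2πi⟨a, ℓ P⟩} 𝓕(T₁ ⊗ T₂)` with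
`ℓ P = ∑_{j ∈ 2nd block} p_j`, so by the exchange theorem
(`SchwartzMap.apply_eq_integral_of_forall_apply_eq_integral`)
`∫ 𝓕g(a) 𝒲_N(T₁ ⊗ τ_a T₂) da = 𝒲̂_N(g(-ℓ ·) 𝓕(T₁ ⊗ T₂))`, and the test function on the right
has support where `-ℓ P ∈ supp g`, i.e. (hypothesis on `g`) where `-ℓ P ∉ V̄₊`, whereas on the
spectral set `-ℓ P = ∑_{j ∈ 1st block} p_j ∈ V̄₊`; so (b) gives `0`.

## References
* R. F. Streater, A. S. Wightman, PCT, Spin and Statistics, and All That (1964), §3-3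
  §3-4, Thm. 3-7 and its proof, p. 110 (the spectral step, from (3-44)).
-/

noncomputable section

open Filter Topology ComplexConjugate MeasureTheory FourierTransform
open scoped InnerProductSpace SchwartzMap ComplexOrder RealInnerProductSpace

namespace Literature.Analysis.FunctionSpaces

namespace WightmanFamily

open Literature.MathematicalPhysics.QuantumLattice

variable {d : ℕ} {κ : Type*} (𝒲 : WightmanFamily d κ)

/-! ## The matrix coefficients of basis vectors -/

/-- A word whose second block is moved by `g`, in `Fin.append` presentation:
`𝒲(L ++ g • L') = 𝒲_{n+m}((⊗L) ⊗ (g • ⊗L'))`. [folklore] -/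
theorem eval_append_map (g : PoincareGroup d) (L L' : Word d κ) :
    eval 𝒲 (L ++ L'.map (actLetter g)) =
      𝒲 (L.length + L'.length) (Fin.append (wordLab L) (wordLab L'))
        (SchwartzMap.appendTensor (wordTensor L) (poincareTestMulti L'.length g (wordTensor L'))) := by
  have hlen : L.length + L'.length = (L ++ L'.map (actLetter g)).length := by simp
  rw [eval]
  refine apply_congr 𝒲 hlen (fun i => ?_) (fun x => ?_)
  · refine Fin.addCases (fun j => ?_) (fun j => ?_) i
    · rw [Fin.append_left, wordLab_apply, wordLab_apply, get_append_castAdd L _ hlen j]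
    · rw [Fin.append_right, wordLab_apply, wordLab_apply, get_append_natAdd L _ hlen j]
      simp [actLetter]
  · rw [SchwartzMap.appendTensor_apply, poincareTestMulti_apply, wordTensor_apply, wordTensor_apply,
      wordTensor_apply, prod_fin_cast hlen, Fin.prod_univ_add]
    congr 1
    · refine Finset.prod_congr rfl fun j _ => ?_
      rw [get_append_castAdd L _ hlen j]
      rfl
    · refine Finset.prod_congr rfl fun j _ => ?_
      rw [get_append_natAdd L _ hlen j]
      simp [actLetter, poincareTest_apply]

namespace GNSSpace

variable {𝒲} {h𝒲 : IsWightmanFamily 𝒲}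

/-- Translation by `a` as an element of the Poincaré group. [folklore] -/
abbrev transl (a : SpaceTime d) : PoincareGroup d := SemidirectProduct.inl (Multiplicative.ofAdd a)

/-- **Matrix coefficients of basis vectors**:
`⟪[δ_l], U(a) [δ_{l'}]⟫ = 𝒲_{n+m}((⊗ l†) ⊗ τ_a (⊗ l'))`. [folklore] -/
theorem inner_δ_U_transl_δ (l l' : Word d κ) (a : SpaceTime d) :
    ⟪ι 𝒲 h𝒲 (δ 𝒲 h𝒲 l), U 𝒲 h𝒲 (transl a) (ι 𝒲 h𝒲 (δ 𝒲 h𝒲 l'))⟫_ℂ =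
      𝒲 ((WightmanData.starList l).length + l'.length)
        (Fin.append (wordLab (WightmanData.starList l)) (wordLab l'))
        (SchwartzMap.appendTensor (wordTensor (WightmanData.starList l))
          (translateMulti a (wordTensor l'))) := by
  rw [U_ι, act_δ, inner_ι_ι, inner_δ_δ, pairing, eval_append_map, poincareTestMulti_inl]

end GNSSpace

/-! ## Geometry of the flattening -/

section Flatten

variable (d)

/-- The vector `(0, …, 0, a, …, a)` (zero on the first `n` slots, `a` on the last `m`). [folklore] -/
def diagVec (n m : ℕ) (a : SpaceTime d) : Fin (n + m) → SpaceTime d :=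
  Fin.append (fun _ : Fin n => (0 : SpaceTime d)) (fun _ : Fin m => a)

/-- `diagVec` is linear in `a`. [folklore] -/
def diagVecL (n m : ℕ) : SpaceTime d →ₗ[ℝ] (Fin (n + m) → SpaceTime d) where
  toFun := diagVec d n m
  map_add' a b := by
    funext i; refine Fin.addCases (fun j => ?_) (fun j => ?_) i <;> simp [diagVec]
  map_smul' c a := by
    funext i; refine Fin.addCases (fun j => ?_) (fun j => ?_) i <;> simp [diagVec]

/-- The **block momentum** `ℓ P = ∑_{j ∈ 2nd block} p_j` of a flattened momentum configuration,
as a continuous linear map. [folklore] -/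
def blockMomentum (n m : ℕ) : EuclideanSpace ℝ (Fin (n + m) × Fin (d + 1)) →L[ℝ] SpaceTime d :=
  ((∑ j : Fin m, ContinuousLinearMap.proj (R := ℝ) (φ := fun _ : Fin (n + m) => SpaceTime d)
      (Fin.natAdd n j) : (Fin (n + m) → SpaceTime d) →L[ℝ] SpaceTime d)).comp
    ((flattenCLE d (n + m)).symm : EuclideanSpace ℝ (Fin (n + m) × Fin (d + 1)) →L[ℝ]
      (Fin (n + m) → SpaceTime d))

/-- Pointwise formula for `blockMomentum`. [folklore] -/
theorem blockMomentum_apply (n m : ℕ) (P : EuclideanSpace ℝ (Fin (n + m) × Fin (d + 1))) :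
    blockMomentum d n m P = ∑ j : Fin m, (flattenCLE d (n + m)).symm P (Fin.natAdd n j) := by
  simp [blockMomentum]

/-- **Adjointness**: `⟪flatten (0,…,0,a,…,a), P⟫ = ⟪a, ℓ P⟫`. [folklore] -/
theorem inner_flattenCLE_diagVec (n m : ℕ) (a : SpaceTime d)
    (P : EuclideanSpace ℝ (Fin (n + m) × Fin (d + 1))) :
    ⟪flattenCLE d (n + m) (diagVec d n m a), P⟫ = ⟪a, blockMomentum d n m P⟫ := by
  rw [blockMomentum_apply, inner_sum]
  simp only [EuclideanSpace.inner_eq_star_dotProduct, dotProduct, star_trivial, Fintype.sum_prod_type,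
    flattenCLE_apply, flattenCLE_symm_apply]
  rw [Fin.sum_univ_add]
  simp [diagVec, mul_comm]

variable {d}

/-- Translating the second block of a tensor product is translating by `diagVec`. [folklore] -/
theorem appendTensor_translateMulti {n m : ℕ} (T₁ : 𝓢((Fin n → SpaceTime d), ℂ))
    (T₂ : 𝓢((Fin m → SpaceTime d), ℂ)) (a : SpaceTime d) :
    SchwartzMap.appendTensor T₁ (translateMulti a T₂) =
      SchwartzMap.compSubConstCLM ℂ (diagVec d n m a) (SchwartzMap.appendTensor T₁ T₂) := by
  ext x
  simp only [SchwartzMap.appendTensor_apply, translateMulti_apply, SchwartzMap.compSubConstCLM_apply]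
  congr 1
  · congr 1; funext j; simp [diagVec]
  · congr 1; funext j; simp [diagVec]

/-- Flattening commutes with translations. [folklore] -/
theorem flattenTest_compSubConstCLM {N : ℕ} (v : Fin N → SpaceTime d)
    (F : 𝓢((Fin N → SpaceTime d), ℂ)) :
    flattenTest (SchwartzMap.compSubConstCLM ℂ v F) =
      SchwartzMap.compSubConstCLM ℂ (flattenCLE d N v) (flattenTest F) := by
  ext Y
  simp only [flattenTest_apply, SchwartzMap.compSubConstCLM_apply, map_sub,
    ContinuousLinearEquiv.symm_apply_apply]

end Flatten

/-! ## The Fourier side -/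

section FourierSide

variable {N : ℕ}

/-- **Fourier transform of a translate**: `𝓕(G(· - v))(P) = e^{-2πi⟨v, P⟩} 𝓕G(P)`. [folklore] -/
theorem fourier_compSubConstCLM_apply (v : EuclideanSpace ℝ (Fin N × Fin (d + 1)))
    (G : 𝓢(EuclideanSpace ℝ (Fin N × Fin (d + 1)), ℂ)) (P : EuclideanSpace ℝ (Fin N × Fin (d + 1))) :
    (𝓕 (SchwartzMap.compSubConstCLM ℂ v G)) P = (𝐞 (-⟪v, P⟫) : ℂ) * (𝓕 G) P := by
  rw [SchwartzMap.fourier_coe, SchwartzMap.fourier_coe]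
  have h : ⇑(SchwartzMap.compSubConstCLM ℂ v G) = (G : _ → ℂ) ∘ fun Y => Y + (-v) := by
    funext Y; simp [SchwartzMap.compSubConstCLM_apply, sub_eq_add_neg]
  rw [h]
  have := congrFun (VectorFourier.fourierIntegral_comp_add_right 𝐞 volume (innerₗ _)
    (G : _ → ℂ) (-v)) P
  simp only [Circle.smul_def, smul_eq_mul] at this
  have hI : ((innerₗ (EuclideanSpace ℝ (Fin N × Fin (d + 1)))) (-v)) P = -⟪v, P⟫ := by
    change ⟪-v, P⟫ = -⟪v, P⟫
    exact inner_neg_left v P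
  rw [hI] at this
  exact this

/-- **Double Fourier transform**: `∫ 𝓕g(a) e^{-2πi⟨a, ξ⟩} da = g(-ξ)` for Schwartz `g`. [folklore] -/
theorem integral_fourier_mul_fourierChar (g : 𝓢(SpaceTime d, ℂ)) (ξ : SpaceTime d) :
    ∫ a, (𝓕 g : 𝓢(SpaceTime d, ℂ)) a * (𝐞 (-⟪a, ξ⟫) : ℂ) = g (-ξ) := by
  set h : SpaceTime d → ℂ := ⇑(𝓕 g : 𝓢(SpaceTime d, ℂ))
  have h1 : (𝓕 h) ξ = ∫ a, 𝐞 (-⟪a, ξ⟫) • h a := Real.fourier_eq _ _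
  have h2 : (𝓕 h) ξ = g (-ξ) := by
    have h3 := Real.fourierInv_eq_fourier_neg h (-ξ)
    rw [neg_neg] at h3
    rw [← h3]
    change (𝓕⁻ (⇑(𝓕 g : 𝓢(SpaceTime d, ℂ)))) (-ξ) = g (-ξ)
    rw [← SchwartzMap.fourierInv_coe, fourierInv_fourier_eq]
  rw [← h2, h1]
  refine integral_congr_ae (Eventually.of_forall fun a => ?_)
  simp only [Circle.smul_def, smul_eq_mul]
  ring

end FourierSide



/-! ## The spectral set and the block momentum -/

section SpectralGeometry

variable (d)

/-- The closed forward cone is invariant under positive scaling. [folklore] -/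
theorem smul_mem_closedForwardCone {c : ℝ} (hc : 0 < c) {p : SpaceTime d}
    (hp : p ∈ closedForwardCone d) : c • p ∈ closedForwardCone d := by
  rw [mem_closedForwardCone_iff] at hp ⊢
  rw [map_smul, norm_smul, Real.norm_of_nonneg hc.le, PiLp.smul_apply, smul_eq_mul]
  exact mul_le_mul_of_nonneg_left hp hc.le

/-- `0 ∈ V̄₊`. [folklore] -/
theorem zero_mem_closedForwardCone : (0 : SpaceTime d) ∈ closedForwardCone d := by
  rw [mem_closedForwardCone_iff]; simp

/-- On the spectral set, the sum over the first block of momenta lies in `V̄₊`. [folklore] -/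
theorem sum_castAdd_mem_closedForwardCone_of_mem_spectralSet (n m : ℕ) {p : Fin (n + m) → SpaceTime d}
    (hp : p ∈ spectralSet d (n + m)) : ∑ i : Fin n, p (Fin.castAdd m i) ∈ closedForwardCone d := by
  rcases Nat.eq_zero_or_pos n with hn | hn
  · subst hn
    simp only [Finset.univ_eq_empty, Finset.sum_empty]
    exact zero_mem_closedForwardCone d
  · obtain ⟨n', rfl⟩ : ∃ n', n = n' + 1 := ⟨n - 1, by omega⟩
    set k : Fin (n' + 1 + m) := Fin.castAdd m ⟨n', Nat.lt_succ_self n'⟩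
    have hk := hp.2 k
    have hset : Finset.Iic k = (Finset.univ : Finset (Fin (n' + 1))).map (Fin.castAddEmb m) := by
      ext j
      simp only [Finset.mem_Iic, Finset.mem_map, Finset.mem_univ, true_and, Fin.castAddEmb_apply]
      constructor
      · intro hj
        have hj' : (j : ℕ) ≤ n' := by
          have := Fin.le_def.1 hj
          simpa [k] using this
        exact ⟨⟨j, by omega⟩, Fin.ext rfl⟩
      · rintro ⟨i, rfl⟩
        rw [Fin.le_def]
        simp only [k, Fin.val_castAdd]
        have := i.2
        omega
    rw [hset, Finset.sum_map] at hk
    exact hk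

/-- On the (flattened) spectral set, `-ℓ P ∈ V̄₊`. [folklore] -/
theorem neg_blockMomentum_mem_of_mem_spectralSet (n m : ℕ)
    {P : EuclideanSpace ℝ (Fin (n + m) × Fin (d + 1))}
    (hP : P ∈ flattenCLE d (n + m) '' spectralSet d (n + m)) :
    -blockMomentum d n m P ∈ closedForwardCone d := by
  obtain ⟨p, hp, rfl⟩ := hP
  rw [blockMomentum_apply]
  simp only [ContinuousLinearEquiv.symm_apply_apply]
  have hsum : ∑ i : Fin n, p (Fin.castAdd m i) + ∑ j : Fin m, p (Fin.natAdd n j) = 0 := by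
    rw [← Fin.sum_univ_add]; exact hp.1
  have : -∑ j : Fin m, p (Fin.natAdd n j) = ∑ i : Fin n, p (Fin.castAdd m i) := by
    rw [neg_eq_iff_add_eq_zero, add_comm]; exact hsum
  rw [this]
  exact sum_castAdd_mem_closedForwardCone_of_mem_spectralSet d n m hp

variable {d}

/-- The support of a product with a composition is contained in the preimage of the support. [folklore] -/
theorem tsupport_smulLeftCLM_subset {N : ℕ} (g : 𝓢(SpaceTime d, ℂ))
    (L : EuclideanSpace ℝ (Fin N × Fin (d + 1)) →L[ℝ] SpaceTime d)
    (G : 𝓢(EuclideanSpace ℝ (Fin N × Fin (d + 1)), ℂ)) :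
    tsupport (SchwartzMap.smulLeftCLM ℂ (fun P => g (L P)) G :
        EuclideanSpace ℝ (Fin N × Fin (d + 1)) → ℂ) ⊆ (fun P => L P) ⁻¹' tsupport g := by
  have hg : Function.HasTemperateGrowth fun P => g (L P) :=
    g.hasTemperateGrowth.comp L.hasTemperateGrowth
  refine closure_minimal ?_ ((isClosed_tsupport _).preimage L.continuous)
  intro P hP
  rw [Function.mem_support, SchwartzMap.smulLeftCLM_apply_apply hg] at hP
  have : g (L P) ≠ 0 := fun h => hP (by rw [h, zero_smul])
  exact subset_tsupport _ this

end SpectralGeometry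

/-! ## The core computation: basis matrix coefficients -/

namespace GNSSpace

variable {𝒲} {h𝒲 : IsWightmanFamily 𝒲}

/-- **Basis matrix coefficients have Fourier spectrum in the forward cone**: for a Schwartz
function `g` supported where `2π ξ ∉ V̄₊`,
`∫ 𝓕g(a) ⟪[δ_l], U(a) [δ_{l'}]⟫ da = 0` (Streater–Wightman (1964), §3-4, proof of Thm. 3-7, p. 110 (from (3-44)), from the
spectral condition (b) via the exchange theorem). [cite: StreaterWightman1964, §3-4, proof of Thm. 3-7, p. 110 (from (3-44))] -/
theorem integral_fourier_mul_inner_δ_U_δ (l l' : Word d κ) (g : 𝓢(SpaceTime d, ℂ))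
    (hg : tsupport (g : SpaceTime d → ℂ) ⊆
      ((fun ξ : SpaceTime d => (2 * Real.pi) • ξ) ⁻¹' closedForwardCone d)ᶜ) :
    ∫ a, (𝓕 g : 𝓢(SpaceTime d, ℂ)) a *
      ⟪ι 𝒲 h𝒲 (δ 𝒲 h𝒲 l), U 𝒲 h𝒲 (transl a) (ι 𝒲 h𝒲 (δ 𝒲 h𝒲 l'))⟫_ℂ = 0 := by
  -- notation
  set L := WightmanData.starList l
  set n := L.length
  set m := l'.length
  set lab : Fin (n + m) → κ := Fin.append (wordLab L) (wordLab l')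
  set T₁ : 𝓢((Fin n → SpaceTime d), ℂ) := wordTensor L
  set T₂ : 𝓢((Fin m → SpaceTime d), ℂ) := wordTensor l'
  set W : 𝓢((Fin (n + m) → SpaceTime d), ℂ) →L[ℂ] ℂ := 𝒲 (n + m) lab
  simp only [inner_δ_U_transl_δ]
  -- the Fourier side
  set G : 𝓢((Fin (n + m) → SpaceTime d), ℂ) := SchwartzMap.appendTensor T₁ T₂
  set Gf : 𝓢(EuclideanSpace ℝ (Fin (n + m) × Fin (d + 1)), ℂ) := flattenTest G
  set FT : 𝓢(EuclideanSpace ℝ (Fin (n + m) × Fin (d + 1)), ℂ) →L[ℂ]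
      𝓢(EuclideanSpace ℝ (Fin (n + m) × Fin (d + 1)), ℂ) := SchwartzMap.fourierTransformCLM ℂ
  set G₀ : 𝓢(EuclideanSpace ℝ (Fin (n + m) × Fin (d + 1)), ℂ) := FT Gf
  set vmap : SpaceTime d →L[ℝ] EuclideanSpace ℝ (Fin (n + m) × Fin (d + 1)) :=
    (flattenCLE d (n + m) : (Fin (n + m) → SpaceTime d) →L[ℝ] _).comp
      (LinearMap.toContinuousLinearMap (diagVecL d n m))
  have hvmap : ∀ a, vmap a = flattenCLE d (n + m) (diagVec d n m a) := fun a => rfl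
  set Ψ : SpaceTime d → 𝓢(EuclideanSpace ℝ (Fin (n + m) × Fin (d + 1)), ℂ) := fun a =>
    FT (SchwartzMap.compSubConstCLM ℂ (vmap a) Gf)
  have hΨeq : ∀ a, flattenTest (SchwartzMap.appendTensor T₁ (translateMulti a T₂)) =
      SchwartzMap.compSubConstCLM ℂ (vmap a) Gf := by
    intro a; rw [appendTensor_translateMulti, flattenTest_compSubConstCLM]; rfl
  -- the tempered distribution on the Fourier side
  set unflat : 𝓢(EuclideanSpace ℝ (Fin (n + m) × Fin (d + 1)), ℂ) →L[ℂ]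
      𝓢((Fin (n + m) → SpaceTime d), ℂ) :=
    SchwartzMap.compCLMOfContinuousLinearEquiv ℂ (flattenCLE d (n + m))
  have hunflat : ∀ F : 𝓢((Fin (n + m) → SpaceTime d), ℂ), unflat (flattenTest F) = F := fun F => by
    ext x; simp [unflat, flattenTest_apply]
  have hflat : ∀ H : 𝓢(EuclideanSpace ℝ (Fin (n + m) × Fin (d + 1)), ℂ),
      flattenTest (unflat H) = H := fun H => by
    ext Y; simp [unflat, flattenTest_apply]
  set FTinv : 𝓢(EuclideanSpace ℝ (Fin (n + m) × Fin (d + 1)), ℂ) →L[ℂ]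
      𝓢(EuclideanSpace ℝ (Fin (n + m) × Fin (d + 1)), ℂ) :=
    ((FourierTransform.fourierCLE ℂ (𝓢(EuclideanSpace ℝ (Fin (n + m) × Fin (d + 1)), ℂ))).symm :
      𝓢(EuclideanSpace ℝ (Fin (n + m) × Fin (d + 1)), ℂ) →L[ℂ]
        𝓢(EuclideanSpace ℝ (Fin (n + m) × Fin (d + 1)), ℂ))
  have hFTinv : ∀ H, FTinv H = 𝓕⁻ H := fun H => rfl
  have hFT : ∀ H, FT H = 𝓕 H := fun H => rfl
  set S : 𝓢(EuclideanSpace ℝ (Fin (n + m) × Fin (d + 1)), ℂ) →L[ℂ] ℂ := W.comp (unflat.comp FTinv)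
  have hS : ∀ a, S (Ψ a) = W (SchwartzMap.appendTensor T₁ (translateMulti a T₂)) := by
    intro a
    change W (unflat (FTinv (FT (SchwartzMap.compSubConstCLM ℂ (vmap a) Gf)))) = _
    rw [hFTinv, hFT, fourierInv_fourier_eq, ← hΨeq, hunflat]
  -- the test function `K = g(-ℓ ·) • G₀`
  set ℓ : EuclideanSpace ℝ (Fin (n + m) × Fin (d + 1)) →L[ℝ] SpaceTime d := blockMomentum d n m
  have hm : Function.HasTemperateGrowth fun P => g ((-ℓ) P) :=
    g.hasTemperateGrowth.comp (-ℓ).hasTemperateGrowth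
  set K : 𝓢(EuclideanSpace ℝ (Fin (n + m) × Fin (d + 1)), ℂ) :=
    SchwartzMap.smulLeftCLM ℂ (fun P => g ((-ℓ) P)) G₀
  have hK : ∀ P, K P = ∫ a, (𝓕 g : 𝓢(SpaceTime d, ℂ)) a * Ψ a P := by
    intro P
    rw [SchwartzMap.smulLeftCLM_apply_apply hm, smul_eq_mul]
    have hΨP : ∀ a, Ψ a P = (𝐞 (-⟪vmap a, P⟫) : ℂ) * G₀ P := fun a => by
      change (𝓕 (SchwartzMap.compSubConstCLM ℂ (vmap a) Gf)) P = _
      rw [fourier_compSubConstCLM_apply]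
      rfl
    have hinner : ∀ a, ⟪vmap a, P⟫ = ⟪a, ℓ P⟫ := fun a => by
      rw [hvmap]; exact inner_flattenCLE_diagVec d n m a P
    simp only [hΨP, hinner, ← mul_assoc]
    rw [integral_mul_const, integral_fourier_mul_fourierChar]
    simp
  -- hypotheses of the exchange theorem
  have hΨc : Continuous Ψ :=
    FT.continuous.comp ((continuous_compSubConstCLM ℂ Gf).comp vmap.continuous)
  have hgrowth : ∀ k n' : ℕ, ∃ (C : ℝ) (N : ℕ), ∀ a,
      SchwartzMap.seminorm ℂ k n' (Ψ a) ≤ C * (1 + ‖a‖) ^ N := fun k n' =>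
    SchwartzMap.exists_seminorm_clm_compSubConstCLM_le FT Gf vmap k n'
  have hw : Continuous fun a => (𝓕 g : 𝓢(SpaceTime d, ℂ)) a := (𝓕 g : 𝓢(SpaceTime d, ℂ)).continuous
  have hwi : ∀ N : ℕ, Integrable (fun a => (1 + ‖a‖) ^ N * ‖(𝓕 g : 𝓢(SpaceTime d, ℂ)) a‖) :=
    fun N => SchwartzMap.integrable_one_add_norm_pow_mul (𝓕 g : 𝓢(SpaceTime d, ℂ)) N
  have hex := SchwartzMap.apply_eq_integral_of_forall_apply_eq_integral S Ψ hΨc hgrowth _ hw hwi K hK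
  simp only [hS] at hex
  rw [← hex]
  -- `S K = W (unflat (𝓕⁻ K)) = 0` by the spectral condition (b)
  change W (unflat (FTinv K)) = 0
  refine h𝒲.spectral (n + m) lab _ ?_
  rw [SchwartzMap.fourierTransformCLM_apply, hFTinv, hflat, fourier_fourierInv_eq]
  refine Set.disjoint_left.2 fun P hPK hPspec => ?_
  have h1 : (-ℓ) P ∈ tsupport (g : SpaceTime d → ℂ) := tsupport_smulLeftCLM_subset g (-ℓ) G₀ hPK
  have h2 : -ℓ P ∈ closedForwardCone d := neg_blockMomentum_mem_of_mem_spectralSet d n m hPspec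
  have h3 := hg h1
  refine h3 ?_
  change (2 * Real.pi) • ((-ℓ) P) ∈ closedForwardCone d
  rw [neg_apply]
  exact smul_mem_closedForwardCone d Real.two_pi_pos h2

/-! ## From basis vectors to all vectors -/

/-- The integrand of the Fourier-transformed matrix coefficient is integrable. [folklore] -/
theorem integrable_fourier_mul_inner_U (g : 𝓢(SpaceTime d, ℂ)) (φ ψ : GNSHilbert 𝒲 h𝒲) :
    Integrable fun a => (𝓕 g : 𝓢(SpaceTime d, ℂ)) a * ⟪φ, U 𝒲 h𝒲 (transl a) ψ⟫_ℂ := by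
  have hc : Continuous fun a : SpaceTime d => U 𝒲 h𝒲 (transl a) ψ :=
    continuous_U_apply (h𝒲 := h𝒲) (fun a : SpaceTime d => transl a) continuous_poincareTestMulti_inl ψ
  refine Integrable.mono' (((𝓕 g : 𝓢(SpaceTime d, ℂ)).integrable).norm.mul_const (‖φ‖ * ‖ψ‖))
    (((𝓕 g : 𝓢(SpaceTime d, ℂ)).continuous.mul (continuous_const.inner hc)).aestronglyMeasurable)
    (Eventually.of_forall fun a => ?_)
  rw [norm_mul]
  gcongr
  calc ‖⟪φ, U 𝒲 h𝒲 (transl a) ψ⟫_ℂ‖ ≤ ‖φ‖ * ‖U 𝒲 h𝒲 (transl a) ψ‖ := norm_inner_le_norm _ _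
    _ = ‖φ‖ * ‖ψ‖ := by rw [LinearIsometryEquiv.norm_map]

/-- Bound for the Fourier-transformed matrix coefficient. [folklore] -/
theorem norm_integral_fourier_mul_inner_U_le (g : 𝓢(SpaceTime d, ℂ)) (φ ψ : GNSHilbert 𝒲 h𝒲) :
    ‖∫ a, (𝓕 g : 𝓢(SpaceTime d, ℂ)) a * ⟪φ, U 𝒲 h𝒲 (transl a) ψ⟫_ℂ‖ ≤
      (∫ a, ‖(𝓕 g : 𝓢(SpaceTime d, ℂ)) a‖) * (‖φ‖ * ‖ψ‖) := by
  rw [← integral_mul_const]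
  refine norm_integral_le_of_norm_le
    (((𝓕 g : 𝓢(SpaceTime d, ℂ)).integrable).norm.mul_const _) (Eventually.of_forall fun a => ?_)
  rw [norm_mul]
  gcongr
  calc ‖⟪φ, U 𝒲 h𝒲 (transl a) ψ⟫_ℂ‖ ≤ ‖φ‖ * ‖U 𝒲 h𝒲 (transl a) ψ‖ := norm_inner_le_norm _ _
    _ = ‖φ‖ * ‖ψ‖ := by rw [LinearIsometryEquiv.norm_map]

/-- The Fourier-transformed matrix coefficient is additive and continuous in each vector, so
that its vanishing extends from the dense domain. [folklore] -/
theorem integral_fourier_mul_inner_U_eq_zero (g : 𝓢(SpaceTime d, ℂ))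
    (hg : tsupport (g : SpaceTime d → ℂ) ⊆
      ((fun ξ : SpaceTime d => (2 * Real.pi) • ξ) ⁻¹' closedForwardCone d)ᶜ)
    (φ ψ : GNSHilbert 𝒲 h𝒲) :
    ∫ a, (𝓕 g : 𝓢(SpaceTime d, ℂ)) a * ⟪φ, U 𝒲 h𝒲 (transl a) ψ⟫_ℂ = 0 := by
  set w : SpaceTime d → ℂ := fun a => (𝓕 g : 𝓢(SpaceTime d, ℂ)) a
  set B : GNSHilbert 𝒲 h𝒲 → GNSHilbert 𝒲 h𝒲 → ℂ := fun φ ψ =>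
    ∫ a, w a * ⟪φ, U 𝒲 h𝒲 (transl a) ψ⟫_ℂ
  set Cw : ℝ := ∫ a, ‖w a‖
  -- additivity in each argument
  have hsub₁ : ∀ φ φ' ψ, B φ ψ - B φ' ψ = B (φ - φ') ψ := by
    intro φ φ' ψ
    simp only [B]
    rw [← integral_sub (integrable_fourier_mul_inner_U g φ ψ) (integrable_fourier_mul_inner_U g φ' ψ)]
    refine integral_congr_ae (Eventually.of_forall fun a => ?_)
    simp only [inner_sub_left]; ring
  have hsub₂ : ∀ φ ψ ψ', B φ ψ - B φ ψ' = B φ (ψ - ψ') := by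
    intro φ ψ ψ'
    simp only [B]
    rw [← integral_sub (integrable_fourier_mul_inner_U g φ ψ) (integrable_fourier_mul_inner_U g φ ψ')]
    refine integral_congr_ae (Eventually.of_forall fun a => ?_)
    simp only [map_sub, inner_sub_right]; ring
  -- continuity in each argument
  have hcont₁ : ∀ ψ, Continuous fun φ => B φ ψ := by
    intro ψ
    refine continuous_iff_continuousAt.2 fun φ₀ => ?_
    rw [ContinuousAt, tendsto_iff_norm_sub_tendsto_zero]
    have hb : ∀ φ, ‖B φ ψ - B φ₀ ψ‖ ≤ Cw * (‖φ - φ₀‖ * ‖ψ‖) := fun φ => by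
      rw [hsub₁]; exact norm_integral_fourier_mul_inner_U_le g _ _
    have hlim : Tendsto (fun φ : GNSHilbert 𝒲 h𝒲 => Cw * (‖φ - φ₀‖ * ‖ψ‖)) (𝓝 φ₀) (𝓝 0) := by
      have : Continuous fun φ : GNSHilbert 𝒲 h𝒲 => Cw * (‖φ - φ₀‖ * ‖ψ‖) := by fun_prop
      simpa using this.tendsto φ₀
    exact squeeze_zero (fun _ => norm_nonneg _) hb hlim
  have hcont₂ : ∀ φ, Continuous fun ψ => B φ ψ := by
    intro φ
    refine continuous_iff_continuousAt.2 fun ψ₀ => ?_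
    rw [ContinuousAt, tendsto_iff_norm_sub_tendsto_zero]
    have hb : ∀ ψ, ‖B φ ψ - B φ ψ₀‖ ≤ Cw * (‖φ‖ * ‖ψ - ψ₀‖) := fun ψ => by
      rw [hsub₂]; exact norm_integral_fourier_mul_inner_U_le g _ _
    have hlim : Tendsto (fun ψ : GNSHilbert 𝒲 h𝒲 => Cw * (‖φ‖ * ‖ψ - ψ₀‖)) (𝓝 ψ₀) (𝓝 0) := by
      have : Continuous fun ψ : GNSHilbert 𝒲 h𝒲 => Cw * (‖φ‖ * ‖ψ - ψ₀‖) := by fun_prop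
      simpa using this.tendsto ψ₀
    exact squeeze_zero (fun _ => norm_nonneg _) hb hlim
  -- vanishing on the dense domain
  have hdense : ∀ u v : GNSSpace 𝒲 h𝒲, B (ι 𝒲 h𝒲 u) (ι 𝒲 h𝒲 v) = 0 := by
    intro u v
    rw [← of_symm_eq u, ← of_symm_eq v]
    set u' := (of 𝒲 h𝒲).symm u
    set v' := (of 𝒲 h𝒲).symm v
    have hexp : ∀ a, w a * ⟪ι 𝒲 h𝒲 (of 𝒲 h𝒲 u'), U 𝒲 h𝒲 (transl a) (ι 𝒲 h𝒲 (of 𝒲 h𝒲 v'))⟫_ℂ =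
        ∑ l ∈ u'.support, ∑ l' ∈ v'.support, conj (u' l) * v' l' *
          (w a * ⟪ι 𝒲 h𝒲 (δ 𝒲 h𝒲 l), U 𝒲 h𝒲 (transl a) (ι 𝒲 h𝒲 (δ 𝒲 h𝒲 l'))⟫_ℂ) := by
      intro a
      rw [of_eq_sum u', of_eq_sum v', map_sum, map_sum, map_sum (U 𝒲 h𝒲 (transl a)), sum_inner,
        Finset.mul_sum]
      refine Finset.sum_congr rfl fun l _ => ?_
      rw [inner_sum, Finset.mul_sum]
      refine Finset.sum_congr rfl fun l' _ => ?_
      rw [map_smul, map_smul, map_smul, inner_smul_left, inner_smul_right]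
      ring
    simp only [B, hexp]
    rw [integral_finsetSum _ fun l _ => ?_]
    · refine Finset.sum_eq_zero fun l _ => ?_
      rw [integral_finsetSum _ fun l' _ => ?_]
      · refine Finset.sum_eq_zero fun l' _ => ?_
        rw [integral_const_mul, integral_fourier_mul_inner_δ_U_δ l l' g hg, mul_zero]
      · exact (integrable_fourier_mul_inner_U g _ _).const_mul _
    · exact integrable_finsetSum _ fun l' _ => (integrable_fourier_mul_inner_U g _ _).const_mul _
  -- extend by density: first in `φ`, then in `ψ`
  have hstep : ∀ v : GNSSpace 𝒲 h𝒲, B φ (ι 𝒲 h𝒲 v) = 0 := fun v =>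
    denseRange_ι.induction_on (p := fun φ => B φ (ι 𝒲 h𝒲 v) = 0) φ
      (isClosed_eq (hcont₁ _) continuous_const) (fun u => hdense u v)
  exact denseRange_ι.induction_on (p := fun ψ => B φ ψ = 0) ψ
    (isClosed_eq (hcont₂ _) continuous_const) hstep

/-! ## The named fact and the reconstruction theorem -/

/-- **Discharge of `GNS_spectral_condition`**: the translation group of the GNS Hilbert space
has Fourier spectrum in the closed forward cone (Streater–Wightman (1964), §3-4, Thm. 3-7,
spectral step, p. 110, from (3-44)). [cite: StreaterWightman1964, §3-4, proof of Thm. 3-7, p. 110 (from (3-44))] -/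
theorem _root_.Literature.Analysis.FunctionSpaces.GNS_spectral_condition_holds : GNS_spectral_condition := by
  intro d κ 𝒲 h𝒲 φ ψ g hg
  exact integral_fourier_mul_inner_U_eq_zero g hg φ ψ

end GNSSpace

end WightmanFamily

/-- **Wightman reconstruction, existence (Streater–Wightman (1964), Thm. 3-7), `d ≥ 1`**:
fully proved. [cite: StreaterWightman1964, §3-4 Thm. 3-7] -/
theorem wightman_reconstruction_exists_holds {d : ℕ} [NeZero d] :
    wightman_reconstruction_exists (d := d) :=
  wightman_reconstruction_exists_of_spectral GNS_spectral_condition_holds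

/-- **The Wightman reconstruction theorem (Streater–Wightman (1964), Thm. 3-7), `d ≥ 1`**:
existence (`wightman_reconstruction_exists_holds`) and uniqueness up to unitary equivalence
(`wightman_reconstruction_unique`, `WightmanFunctionsProofs`) — the named fact
`Literature.Analysis.FunctionSpaces.wightman_reconstruction` fully proved for every space dimension `d ≥ 1`. [cite: StreaterWightman1964, §3-4 Thm. 3-7] -/
theorem wightman_reconstruction_holds {d : ℕ} [NeZero d] : wightman_reconstruction (d := d) :=
  wightman_reconstruction_of_exists wightman_reconstruction_exists_holds

end Literature.Analysis.FunctionSpaces
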